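import Mathlib

/-!
# Vitali's convergence theorem from a uniform `L^q` bound (Landau-tail blow-up line)

Helper file for crux `LandauTailBlowup` (stmt-NavierStokesRegularity-1944), line `registered`,
registered stub `landauTail_tendsto_eLpNorm_two_of_eLpNorm_le` ("Vitali from a uniform `L^q`
bound"): on a finite measure space over `ℝ × ℝ³`, a sequence `f n` that is bounded in `L^q` for
some `2 < q < ∞` and converges a.e. to `g` converges to `g` in `L²`.

Pure measure theory, no PDE: Hölder on indicators (`‖1_s f‖_p ≤ ‖f‖_q μ(s)^{1/p-1/q}`) gives
uniform integrability in `L^p` of any `L^q`-bounded family (`p < q`), Fatou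
(`MeasureTheory.Lp.eLpNorm_le_of_ae_tendsto`) puts the a.e. limit in `L^q ⊆ L²`, and Mathlib's
Vitali convergence theorem `MeasureTheory.tendsto_Lp_finite_of_tendsto_ae` concludes.
-/

set_option linter.dupNamespace false

namespace Summit.NavierStokesRegularity.NavierStokesRegularity.Theorems

open MeasureTheory Set Filter Topology
open scoped ENNReal NNReal

/-- **Hölder on indicators** [folklore]: if `p ≤ q` then for every measurable set `s`,
`‖1_s f‖_{L^p(μ)} ≤ ‖f‖_{L^q(μ)} · μ(s)^{1/p - 1/q}`. -/
theorem landauTail_eLpNorm_indicator_le_mul_rpow {α β : Type*} {m : MeasurableSpace α}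
    [NormedAddCommGroup β] {μ : Measure α} {p q : ℝ≥0∞} (hpq : p ≤ q) {f : α → β}
    (hf : AEStronglyMeasurable f μ) {s : Set α} (hs : MeasurableSet s) :
    eLpNorm (s.indicator f) p μ ≤ eLpNorm f q μ * μ s ^ (1 / p.toReal - 1 / q.toReal) := by
  rw [eLpNorm_indicator_eq_eLpNorm_restrict hs]
  calc eLpNorm f p (μ.restrict s)
      ≤ eLpNorm f q (μ.restrict s) * (μ.restrict s) univ ^ (1 / p.toReal - 1 / q.toReal) :=
        eLpNorm_le_eLpNorm_mul_rpow_measure_univ hpq hf.restrict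
    _ ≤ eLpNorm f q μ * μ s ^ (1 / p.toReal - 1 / q.toReal) := by
        rw [Measure.restrict_apply_univ]
        gcongr
        exact Measure.restrict_le_self

/-- **Uniform integrability from a uniform `L^q` bound** [folklore]: for `1 ≤ p < q < ∞`, a
family of a.e.-strongly measurable functions bounded in `L^q(μ)` is uniformly integrable in
`L^p(μ)` (the indicator norms are `≤ C μ(s)^{1/p-1/q} → 0` as `μ(s) → 0`). -/
theorem landauTail_unifIntegrable_of_eLpNorm_le {α β ι : Type*} {m : MeasurableSpace α}
    [NormedAddCommGroup β] {μ : Measure α} {p q : ℝ≥0∞} (hp : 1 ≤ p) (hpq : p < q) (hq : q ≠ ∞)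
    {f : ι → α → β} (hf : ∀ i, AEStronglyMeasurable (f i) μ) {C : ℝ≥0}
    (hC : ∀ i, eLpNorm (f i) q μ ≤ C) : UnifIntegrable f p μ := by
  set r : ℝ := 1 / p.toReal - 1 / q.toReal with hr_def
  have hp0 : p ≠ 0 := (zero_lt_one.trans_le hp).ne'
  have hr : 0 < r := by
    have h1 : 0 < p.toReal := ENNReal.toReal_pos hp0 hpq.ne_top
    have h2 : p.toReal < q.toReal := ENNReal.toReal_strict_mono hq hpq
    exact sub_pos.2 (one_div_lt_one_div_of_lt h1 h2)
  have key : ∀ i s, MeasurableSet s → eLpNorm (s.indicator (f i)) p μ ≤ C * μ s ^ r := by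
    intro i s hs
    calc eLpNorm (s.indicator (f i)) p μ ≤ eLpNorm (f i) q μ * μ s ^ r :=
          landauTail_eLpNorm_indicator_le_mul_rpow hpq.le (hf i) hs
      _ ≤ C * μ s ^ r := by
          gcongr
          exact hC i
  have ht : Tendsto (fun x : ℝ≥0∞ => (C : ℝ≥0∞) * x ^ r) (𝓝 0) (𝓝 0) := by
    have h1 : Tendsto (fun x : ℝ≥0∞ => x ^ r) (𝓝 0) (𝓝 0) := by
      have h := (ENNReal.continuous_rpow_const (y := r)).tendsto 0
      rwa [ENNReal.zero_rpow_of_pos hr] at h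
    have h2 := ENNReal.Tendsto.const_mul (a := C) h1 (Or.inr ENNReal.coe_ne_top)
    rwa [mul_zero] at h2
  intro ε hε
  obtain ⟨a, ha0, ha⟩ := ENNReal.nhds_zero_basis_Iic.mem_iff.1
    (ht (Iic_mem_nhds (ENNReal.ofReal_pos.2 hε)))
  obtain ⟨δ, -, h0δ, hδa⟩ := ENNReal.lt_iff_exists_real_btwn.1 ha0
  refine ⟨δ, ENNReal.ofReal_pos.1 h0δ, fun i s hs hμs => ?_⟩
  calc eLpNorm (s.indicator (f i)) p μ ≤ C * μ s ^ r := key i s hs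
    _ ≤ ENNReal.ofReal ε := ha (show μ s ∈ Iic a from hμs.trans hδa.le)

/-- **Vitali from a uniform `L^q` bound** [folklore; Vitali's convergence theorem] (registered
stub S1 of crux `LandauTailBlowup`, stmt-NavierStokesRegularity-1944): on a finite measure space
over `ℝ × ℝ³`, if each `f n` is a.e.-strongly measurable, `‖f n‖_{L^q(μ)} ≤ C` for some
`2 < q < ∞`, and `f n → g` a.e., then `‖f n - g‖_{L²(μ)} → 0`.  Proof: the family is uniformly
integrable in `L²` (`landauTail_unifIntegrable_of_eLpNorm_le`), the limit is in `L^q ⊆ L²` by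
Fatou, and `MeasureTheory.tendsto_Lp_finite_of_tendsto_ae` applies. -/
theorem landauTail_tendsto_eLpNorm_two_of_eLpNorm_le : ∀ (μ : MeasureTheory.Measure (ℝ × EuclideanSpace ℝ (Fin 3))) [MeasureTheory.IsFiniteMeasure μ] (f : ℕ → ℝ × EuclideanSpace ℝ (Fin 3) → EuclideanSpace ℝ (Fin 3)) (g : ℝ × EuclideanSpace ℝ (Fin 3) → EuclideanSpace ℝ (Fin 3)) (q : ENNReal), 2 < q → q ≠ ⊤ → (∀ n, MeasureTheory.AEStronglyMeasurable (f n) μ) → (∃ C : NNReal, ∀ n, MeasureTheory.eLpNorm (f n) q μ ≤ C) → (∀ᵐ x ∂μ, Filter.Tendsto (fun n => f n x) Filter.atTop (nhds (g x))) → Filter.Tendsto (fun n => MeasureTheory.eLpNorm (f n - g) 2 μ) Filter.atTop (nhds 0) := by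
  intro μ _ f g q hq2 hqtop hf hbound hfg
  obtain ⟨C, hC⟩ := hbound
  have hgq : MemLp g q μ :=
    ⟨aestronglyMeasurable_of_tendsto_ae atTop hf hfg,
      (Lp.eLpNorm_le_of_ae_tendsto (Eventually.of_forall hC) hf hfg).trans_lt ENNReal.coe_lt_top⟩
  have hg2 : MemLp g 2 μ := hgq.mono_exponent hq2.le
  have hui : UnifIntegrable f 2 μ :=
    landauTail_unifIntegrable_of_eLpNorm_le one_le_two hq2 hqtop hf hC
  exact tendsto_Lp_finite_of_tendsto_ae one_le_two ENNReal.ofNat_ne_top hf hg2 hui hfg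

end Summit.NavierStokesRegularity.NavierStokesRegularity.Theorems
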